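import Mathlib
import Literature.Computability.Complexity.OccurrenceObstructionsIPProofs
import Literature.Computability.AlgebraicComplexity.OrbitCoordinateRingProofs
import Literature.Computability.AlgebraicComplexity.MultiplicityObstructionsProofs
import Literature.Computability.AlgebraicComplexity.PencilFamily
import Literature.Computability.AlgebraicComplexity.DeterminantalComplexityProofs
import Literature.Computability.AlgebraicComplexity.PlethysmLifting
import Literature.NumberTheory.DiophantineGeometry.SchurWeylPlethysmCoordRepWeightsProofs

/-!
# Eventual row-lift transfer of orbit-closure multiplicities along closure points; the determinant
# side `K_n(μ*) ≤ K_{n+j}((μ♯)*)` for all large `j` (crux `ValuativeGCT.ValuativeFlip`,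
# stmt-ValiantsHypothesis-12624; wall-breaker axis "representation-stability transfer `m ↔ m + 1`", k16 gen 1)

The transfer `m ↦ m + j` of `mult_{λ*} ℂ[Δ_m(p)]` to `mult_{(λ♯)*} ℂ[Δ_{m+j}(q)]` (`λ♯ = λ + (jδ)` in the
first row) is OPEN at every fixed `j` for orbit closures (BLMW 2011 Problem 6.10: the Kadish–Landsberg/BIP
lift sees padded points through the twist `Δ_j`, `…PaddingLift.lean`), but holds for all LARGE `j` as
soon as the padded `GL`-orbit of `p` lies in `Δ_{m+j}(q)`.  This file isolates that principle once and
applies it to the determinant: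
* `orbitMultiplicity_le_rowLift_eventually_of_closurePoints` — for a form `p` of degree `m` on `Mat_m` and
  `λ ⊢ mδ` (`≤ m²` parts) there is `j₀(p, λ)` such that for every `j ≥ j₀` and every nonzero form `q` of
  degree `m + j` on `Mat_{m+j}` with `X_top^j · ι(A · p) ∈ Δ_{m+j}(q)` for all `A ∈ GL_{m²}`:
  `mult_{λ*} ℂ[Δ_m(p)] ≤ mult_{(λ♯)*} ℂ[Δ_{m+j}(q)]`.  Proof: a complete evaluation certificate of `p`
  (`D = mult` highest-weight vectors, invertible points, nonsingular matrix); its lifts `liftHWV m j F_i`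
  are highest-weight vectors of weight `(λ♯)*` whose evaluation matrix at the padded points is the
  Δ_j-TWISTED matrix (`aeval_formCoeff_paddedForm_liftHWV`), `(j!)^{δD}` times a polynomial in `j`
  nonzero at `0`; padded points are closure points of `q`, where `I(GL · q)` vanishes (certificate
  bridge).  Per-side instances: `eventualInheritance` / `eventualPaddingTransfer` (k4, k12).
* `paddedForm_linSubst_detFormLex_mem_orbitClosure` — `X_top^j · ι(A · det_m) ∈ Δ(det_{m+j})` for every
  `A ∈ Mat_{m²}` (`A · det_m` has an affine determinantal representation of size `m ≤ m + j`;
  Mulmuley–Sohoni Prop. 4.4 / IP17 Lemma 2.7, in tree as `paddedForm_mem_orbitClosure_detFormLex`).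
* `det_eventualMonotone` (registered stub of the axis, wall-breaker k12, verbatim) — `K_n(μ*) ≤
  K_{n+j}((μ♯(n+j))*)` for all `j ≥ j₀(n, δ, μ)`, `K_m = orbitMultiplicity` of `detFormLex`.  For the crux: along a row-lift ray the
  det-side multiplicity a valuative flip must undercut (`K ≤ dim T_U`, `ValuativeBound`) does not decay;
  with per-side eventual inheritance both sides are eventually co-monotone along `(n, μ) ↦ (n+j, μ♯)`, so
  the transfer moves no flip (bounded-length rays die at `m ≥ 1 + n(n+1)^ℓ`) — it is the first theorem on
  the determinant half of Problem 6.10 and calibrates det-side censuses across sizes.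

Sources: Mulmuley–Sohoni, SIAM J. Comput. 31 (2001) §4–5; BLMW, SIAM J. Comput. 40 (2011) §6.4 Problem
6.10; Ikenmeyer–Panova, Adv. Math. 319 (2017) Prop. 2.6(b), Lemma 2.7; Bürgisser–Ikenmeyer–Panova, J. AMS
32 (2019) Lemma 5.2–5.3, Thm. 5.4; Kadish–Landsberg, Commun. Algebra 42 (2014) §1.
-/

set_option linter.dupNamespace false

namespace Summit.ValiantsHypothesis.ValiantsHypothesis.Theorems.ValuativeFlip

open scoped BigOperators Nat
open MvPolynomial
open Literature.NumberTheory.DiophantineGeometry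
open Literature.Computability.AlgebraicComplexity
open Literature.Computability.Complexity

noncomputable section

/-! ## Private engines (copies, to keep this file's imports inside the built library)

Certificate completeness and the twist polynomial are the landed Parts A–C of
`ValuativeGCTValuativeFlipEventualInheritance` (wall-breaker k4, p115845); the closure-point certificate
bridge is `le_orbitMultiplicity_of_det_ne_zero` / `aeval_formCoeff_eq_zero_of_mem_orbitClosure` of
`ValuativeGCTValuativeFlipCertificateBridge` (wall-breaker k10, p116365). -/

/-- Points of the orbit CLOSURE lie in the zero locus of `I(GL · f)` (`f` a nonzero form of degree `m`).
[Mulmuley–Sohoni 2001 §4; folklore] -/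
private theorem dem_aeval_formCoeff_eq_zero_of_mem_orbitClosure {σ : Type*} [Fintype σ] [LinearOrder σ]
    {m : ℕ} {f q : MvPolynomial σ ℂ} (hf : f.IsHomogeneous m) (hf0 : f ≠ 0) (hq : q ∈ orbitClosure f)
    {G : MvPolynomial (DegIdx σ m) ℂ} (hG : G ∈ orbitVanishingIdeal f m) :
    aeval (formCoeff m q) G = 0 := by
  have h := ((mem_orbitClosure_iff_formCoeff_holds hf hf0).mp hq).2
  rw [MvPolynomial.mem_zeroLocus_iff] at h
  exact h G hG

/-- **Certificate bridge at closure points** (square form): highest-weight vectors `F₁ … F_D` of weight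
`χ` with a nonsingular evaluation matrix at points `q₁ … q_D` of the orbit closure of a nonzero form `f`
of degree `m ≠ 0` certify `D ≤ mult_χ ℂ[Δ_m(f)]` (a vanishing combination of the classes lies in
`I(GL · f)`, vanishes at every `q_l`, and is killed by the nonsingular matrix).
[Bürgisser–Ikenmeyer STOC 2013 §2; BLMW 2011 §4.4; folklore] -/
private theorem dem_le_orbitMultiplicity_of_closure_det_ne_zero {σ : Type} [Fintype σ] [LinearOrder σ]
    {m : ℕ} (hm : m ≠ 0) {f : MvPolynomial σ ℂ} (hf : f.IsHomogeneous m) (hf0 : f ≠ 0) (χ : Weight σ)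
    {D : ℕ} (F : Fin D → MvPolynomial (DegIdx σ m) ℂ) (hF : ∀ i, F i ∈ highestWeightSpace (coordRep σ ℂ m) χ)
    (q : Fin D → MvPolynomial σ ℂ) (hq : ∀ l, q l ∈ orbitClosure f)
    (hdet : (Matrix.of fun i l : Fin D => aeval (formCoeff m (q l)) (F i)).det ≠ 0) :
    D ≤ orbitMultiplicity ℂ f m χ := by
  classical
  haveI : FiniteDimensional ℂ (highestWeightSpace (orbitCoordRep f m) χ) :=
    finiteDimensional_highestWeightSpace_orbitCoordRep_holds (k := ℂ) f hm χ
  -- the classes, as highest-weight vectors of `ℂ[Δ_m(f)]`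
  let v : Fin D → highestWeightSpace (orbitCoordRep f m) χ := fun i =>
    ⟨Ideal.Quotient.mk (orbitVanishingIdeal f m) (F i), mk_mem_highestWeightSpace_orbitCoordRep f (hF i)⟩
  have hli : LinearIndependent ℂ v := by
    rw [Fintype.linearIndependent_iff]
    intro c hc
    -- the combination lies in the ideal
    have hmem : ∑ i, c i • F i ∈ orbitVanishingIdeal f m := by
      rw [← Ideal.Quotient.eq_zero_iff_mem, map_sum]
      have h := congrArg Subtype.val hc
      rw [Submodule.coe_sum, Submodule.coe_zero] at h
      have hsm : ∀ i, Ideal.Quotient.mk (orbitVanishingIdeal f m) (c i • F i) =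
          c i • Ideal.Quotient.mk (orbitVanishingIdeal f m) (F i) := fun i => by
        rw [← Ideal.Quotient.mkₐ_eq_mk ℂ, map_smul]
      simp only [hsm]
      simpa [v] using h
    -- hence vanishes at every closure point `q l`: `c ᵥ* M = 0`
    have hvec : Matrix.vecMul c
        (Matrix.of fun i l : Fin D => aeval (formCoeff m (q l)) (F i)) = 0 := by
      funext l
      have h := dem_aeval_formCoeff_eq_zero_of_mem_orbitClosure hf hf0 (hq l) hmem
      rw [map_sum] at h
      simp only [map_smul, smul_eq_mul] at h
      rw [Matrix.vecMul, dotProduct]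
      simpa [Matrix.of_apply] using h
    exact congrFun (Matrix.eq_zero_of_vecMul_eq_zero hdet hvec)
  exact (Fintype.card_fin D).symm.trans_le hli.fintype_card_le_finrank

/-- Completeness of evaluation certificates: `D ≤ mult_χ ℂ[Δ_m(f)]` gives highest-weight vectors `F₁ … F_D`
and invertible points `A₁ … A_D` with `det (F_i(A_l · f)) ≠ 0` (copy of the landed
`exists_evalCertificate_of_le_orbitMultiplicity`, p115845). [Mulmuley–Sohoni 2001 §4–5; BLMW 2011 §5.2] -/
private theorem dem_exists_evalCertificate :
    ∀ {σ : Type} [Fintype σ] [LinearOrder σ] (f : MvPolynomial σ ℂ) {m : ℕ}, m ≠ 0 → ∀ (χ : Weight σ) {D : ℕ}, D ≤ orbitMultiplicity ℂ f m χ → ∃ (F : Fin D → MvPolynomial (DegIdx σ m) ℂ) (A : Fin D → Matrix σ σ ℂ), (∀ i, F i ∈ highestWeightSpace (coordRep σ ℂ m) χ) ∧ (∀ l, IsUnit (A l)) ∧ (Matrix.of fun i l : Fin D => MvPolynomial.aeval (formCoeff m (linSubst σ ℂ (A l) f)) (F i)).det ≠ 0 := by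
  intro σ _ _ f m hm χ D hD
  classical
  haveI hfin : FiniteDimensional ℂ (highestWeightSpace (orbitCoordRep f m) χ) :=
    finiteDimensional_highestWeightSpace_orbitCoordRep_holds f hm χ
  let π : (coordRep σ ℂ m).IntertwiningMap (orbitCoordRep f m) :=
    ⟨(Ideal.Quotient.mkₐ ℂ (orbitVanishingIdeal f m)).toLinearMap, fun _ => LinearMap.ext fun _ => rfl⟩
  have hπ : Function.Surjective π := Ideal.Quotient.mkₐ_surjective ℂ _
  have hmap := map_highestWeightSpace_eq_of_surjective π hπ (isSemisimpleRepresentation_coordRep m) χ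
  set W := highestWeightSpace (orbitCoordRep f m) χ with hW
  let b := Module.finBasis ℂ W
  have hDle : D ≤ Module.finrank ℂ W := hD
  let w : Fin D → W := fun i => b (Fin.castLE hDle i)
  have hw : LinearIndependent ℂ w := b.linearIndependent.comp _ (Fin.castLE_injective hDle)
  have hlift : ∀ i, ∃ F ∈ highestWeightSpace (coordRep σ ℂ m) χ, π F = (w i : OrbitCoordRing f m) := by
    intro i
    have hmem : (w i : OrbitCoordRing f m) ∈ (highestWeightSpace (coordRep σ ℂ m) χ).map π.toLinearMap := by
      rw [hmap]; exact (w i).2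
    exact Submodule.mem_map.mp hmem
  choose F hF hFw using hlift
  let ev : GL σ ℂ → (Fin D → ℂ) := fun g i => aeval (formCoeff m (linSubst σ ℂ (g : Matrix σ σ ℂ) f)) (F i)
  have hspan : Submodule.span ℂ (Set.range ev) = ⊤ := by
    by_contra hne
    obtain ⟨ψ, hψ0, hψ⟩ := Submodule.exists_le_ker_of_lt_top _ (lt_top_iff_ne_top.mpr hne)
    let c : Fin D → ℂ := fun i => ψ (Pi.single i 1)
    have hψc : ∀ x : Fin D → ℂ, ψ x = ∑ i, x i * c i := by
      intro x
      conv_lhs => rw [show x = ∑ i, x i • (Pi.single i (1 : ℂ) : Fin D → ℂ) from by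
        ext j; simp [Finset.sum_apply, Pi.single_apply]]
      rw [map_sum]
      exact Finset.sum_congr rfl fun i _ => by rw [map_smul, smul_eq_mul]
    have hG : (∑ i, c i • F i) ∈ orbitVanishingIdeal f m := by
      rw [mem_orbitVanishingIdeal_iff]
      intro g
      have hk : ev g ∈ LinearMap.ker ψ := hψ (Submodule.subset_span ⟨g, rfl⟩)
      rw [LinearMap.mem_ker, hψc] at hk
      rw [map_sum]; simp only [map_smul, smul_eq_mul, linSubstRep_apply]; rw [← hk]
      exact Finset.sum_congr rfl fun i _ => by ring
    have hc0 : ∑ i, c i • w i = 0 := by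
      apply Subtype.ext; rw [Submodule.coe_sum, Submodule.coe_zero]; simp only [Submodule.coe_smul]
      have : ∑ i, c i • (w i : OrbitCoordRing f m) = π (∑ i, c i • F i) := by
        rw [map_sum]; exact Finset.sum_congr rfl fun i _ => by rw [map_smul, hFw]
      rw [this, show π (∑ i, c i • F i) = (Ideal.Quotient.mkₐ ℂ (orbitVanishingIdeal f m)) (∑ i, c i • F i) from rfl,
        Ideal.Quotient.mkₐ_eq_mk, Ideal.Quotient.eq_zero_iff_mem]
      exact hG
    have hc : ∀ i, c i = 0 := fun i => Fintype.linearIndependent_iff.mp hw c hc0 i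
    exact hψ0 (LinearMap.ext fun x => by rw [hψc]; simp [hc])
  obtain ⟨t, ht, htspan, htind⟩ := exists_linearIndependent ℂ (Set.range ev)
  rw [hspan] at htspan
  let bt : Module.Basis t ℂ (Fin D → ℂ) := Module.Basis.mk htind (by rw [Subtype.range_coe, htspan])
  let e : t ≃ Fin D := bt.indexEquiv (Pi.basisFun ℂ (Fin D))
  have hpre : ∀ l : Fin D, ∃ g : GL σ ℂ, ev g = ((e.symm l : t) : Fin D → ℂ) := fun l => ht (e.symm l).2
  choose g hg using hpre
  refine ⟨F, fun l => (g l : Matrix σ σ ℂ), hF, fun l => Units.isUnit (g l), ?_⟩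
  set M : Matrix (Fin D) (Fin D) ℂ := Matrix.of fun i l : Fin D => aeval (formCoeff m (linSubst σ ℂ ((g l : GL σ ℂ) : Matrix σ σ ℂ) f)) (F i) with hM
  have hcol : M.col = fun l => ((e.symm l : t) : Fin D → ℂ) := by
    ext l i; rw [← hg l]; rfl
  have hind : LinearIndependent ℂ M.col := by
    rw [hcol]; exact (show LinearIndependent ℂ (fun x : t => (x : Fin D → ℂ)) from htind).comp _ e.symm.injective
  have hU : IsUnit M := Matrix.linearIndependent_cols_iff_isUnit.mp hind
  exact ((Matrix.isUnit_iff_isUnit_det M).mp hU).ne_zero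

/-- `j! · P_e(j) = (e + j).descFactorial j` for the inline twist polynomial `P_e = (X+1)⋯(X+e)/e!` (copy of
the landed `factorial_mul_twistPoly_eval`). [Ikenmeyer–Panova 2017 Prop. 2.6(b); folklore] -/
private theorem dem_factorial_mul_twistPoly_eval (e j : ℕ) :
    ((j ! : ℕ) : ℂ) * (Polynomial.C ((Nat.factorial e : ℂ)⁻¹) * (ascPochhammer ℂ e).comp (Polynomial.X + 1)).eval (j : ℂ) = (((e + j).descFactorial j : ℕ) : ℂ) := by
  have he : (e ! : ℂ) ≠ 0 := by exact_mod_cast Nat.factorial_ne_zero e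
  have h1 : ((j ! : ℕ) : ℂ) * (ascPochhammer ℂ e).eval ((j : ℂ) + 1) = (((j + e) ! : ℕ) : ℂ) := by
    exact_mod_cast factorial_mul_ascPochhammer ℂ j e
  have h2 : ((e ! : ℕ) : ℂ) * (((e + j).descFactorial j : ℕ) : ℂ) = (((e + j) ! : ℕ) : ℂ) := by
    have h := @Nat.factorial_mul_descFactorial (e + j) j (Nat.le_add_left j e)
    rw [Nat.add_sub_cancel] at h
    exact_mod_cast h
  simp only [Polynomial.eval_mul, Polynomial.eval_C, Polynomial.eval_comp,
    Polynomial.eval_add, Polynomial.eval_X, Polynomial.eval_one]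
  rw [add_comm j e] at h1
  field_simp
  linear_combination h1 - h2

/-- Scaling the arguments of a form of degree `δ` by `a` scales its value by `a ^ δ`. [folklore] -/
private theorem dem_aeval_const_mul {ι S : Type*} [CommSemiring S] [Algebra ℂ S] {F : MvPolynomial ι ℂ}
    {δ : ℕ} (hF : F.IsHomogeneous δ) (a : S) (y : ι → S) :
    aeval (fun i => a * y i) F = a ^ δ * aeval y F := by
  classical
  conv_lhs => rw [← F.support_sum_monomial_coeff]
  conv_rhs => rw [← F.support_sum_monomial_coeff]
  rw [map_sum, map_sum, Finset.mul_sum]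
  refine Finset.sum_congr rfl fun s hs => ?_
  rw [aeval_monomial, aeval_monomial, hF.degree_eq_sum_deg_support hs]
  simp only [Finsupp.prod, mul_pow, Finset.prod_mul_distrib, Finset.prod_pow_eq_pow_sum]
  ring

/-- The twisted evaluation of a form of degree `δ` is `(j!)^δ` times a polynomial in `j` (copy of the landed
`twisted_aeval_eq_pow_mul_eval`). [Ikenmeyer–Panova 2017 Prop. 2.6(b); folklore] -/
private theorem dem_twisted_aeval_eq_pow_mul_eval {ι : Type*} (t : ι → ℕ) (c : ι → ℂ)
    {F : MvPolynomial ι ℂ} {δ : ℕ} (hF : F.IsHomogeneous δ) (j : ℕ) :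
    aeval (fun e => (((t e + j).descFactorial j : ℕ) : ℂ) * c e) F =
      ((j ! : ℕ) : ℂ) ^ δ *
        (aeval (fun e => (Polynomial.C ((Nat.factorial (t e) : ℂ)⁻¹) * (ascPochhammer ℂ (t e)).comp (Polynomial.X + 1)) * Polynomial.C (c e)) F).eval (j : ℂ) := by
  have hfun : (fun e => (((t e + j).descFactorial j : ℕ) : ℂ) * c e) =
      fun e => ((j ! : ℕ) : ℂ) * (((Polynomial.C ((Nat.factorial (t e) : ℂ)⁻¹) * (ascPochhammer ℂ (t e)).comp (Polynomial.X + 1))).eval (j : ℂ) * c e) := by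
    funext e
    rw [← mul_assoc, dem_factorial_mul_twistPoly_eval]
  rw [hfun, dem_aeval_const_mul hF]
  congr 1
  rw [← Polynomial.coe_aeval_eq_eval, ← AlgHom.comp_apply, MvPolynomial.comp_aeval]
  refine congrArg (fun v => aeval v F) (funext fun e => ?_)
  simp [Polynomial.coe_aeval_eq_eval]

/-- Generic nonsingularity in the padding: a twisted evaluation matrix nonsingular at `j = 0` is nonsingular
for all `j ≥ j₀` (`det = (j!)^{δD} q(j)`, `q(0) ≠ 0`; copy of the landed `exists_forall_twistedDet_ne_zero`).
[folklore] -/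
private theorem dem_exists_forall_twistedDet_ne_zero {ι : Type*} (t : ι → ℕ) {D δ : ℕ}
    (F : Fin D → MvPolynomial ι ℂ) (hF : ∀ i, (F i).IsHomogeneous δ) (c : Fin D → ι → ℂ)
    (h0 : (Matrix.of fun i l : Fin D => aeval (c l) (F i)).det ≠ 0) :
    ∃ j₀ : ℕ, ∀ j ≥ j₀,
      (Matrix.of fun i l : Fin D =>
        aeval (fun e => (((t e + j).descFactorial j : ℕ) : ℂ) * c l e) (F i)).det ≠ 0 := by
  classical
  let P : Matrix (Fin D) (Fin D) (Polynomial ℂ) :=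
    Matrix.of fun i l : Fin D => aeval (fun e => (Polynomial.C ((Nat.factorial (t e) : ℂ)⁻¹) * (ascPochhammer ℂ (t e)).comp (Polynomial.X + 1)) * Polynomial.C (c l e)) (F i)
  let q : Polynomial ℂ := P.det
  have hdet : ∀ j : ℕ, (Matrix.of fun i l : Fin D =>
      aeval (fun e => (((t e + j).descFactorial j : ℕ) : ℂ) * c l e) (F i)).det =
      (((j ! : ℕ) : ℂ) ^ δ) ^ D * q.eval (j : ℂ) := by
    intro j
    have hM : (Matrix.of fun i l : Fin D =>
        aeval (fun e => (((t e + j).descFactorial j : ℕ) : ℂ) * c l e) (F i)) =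
        (((j ! : ℕ) : ℂ) ^ δ) • (Polynomial.evalRingHom (j : ℂ)).mapMatrix P := by
      ext i l
      simp only [Matrix.of_apply, Matrix.smul_apply, smul_eq_mul, RingHom.mapMatrix_apply,
        Matrix.map_apply, Polynomial.coe_evalRingHom, P]
      exact dem_twisted_aeval_eq_pow_mul_eval t (c l) (hF i) j
    rw [hM, Matrix.det_smul, Fintype.card_fin, ← RingHom.map_det, Polynomial.coe_evalRingHom]
  have hq0 : q.eval 0 ≠ 0 := by
    have h := hdet 0
    simp only [Nat.factorial_zero, Nat.cast_one, one_pow, one_mul, Nat.cast_zero] at h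
    rw [← h]
    have hM0 : (Matrix.of fun i l : Fin D =>
        aeval (fun e => (((t e + 0).descFactorial 0 : ℕ) : ℂ) * c l e) (F i)) =
        Matrix.of fun i l : Fin D => aeval (c l) (F i) := by
      ext i l; simp only [Matrix.of_apply, Nat.descFactorial_zero, Nat.cast_one, one_mul]
    rw [hM0]; exact h0
  have hq : q ≠ 0 := fun h => hq0 (by rw [h, Polynomial.eval_zero])
  have hfin : {j : ℕ | q.eval (j : ℂ) = 0}.Finite := by
    have h1 : {x : ℂ | q.IsRoot x}.Finite := Polynomial.finite_setOf_isRoot hq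
    have h2 : {j : ℕ | q.eval (j : ℂ) = 0} = (fun j : ℕ => (j : ℂ)) ⁻¹' {x : ℂ | q.IsRoot x} := by
      ext j; simp [Polynomial.IsRoot]
    rw [h2]; exact h1.preimage (Nat.cast_injective.injOn)
  obtain ⟨B, hB⟩ := hfin.bddAbove
  refine ⟨B + 1, fun j hj => ?_⟩
  rw [hdet j]
  refine mul_ne_zero (pow_ne_zero _ (pow_ne_zero _ ?_)) fun hroot => ?_
  · exact_mod_cast Nat.factorial_ne_zero j
  · exact absurd (hB hroot) (by omega)

/-! ## The principle: eventual row-lift transfer along closure points -/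

/-- **Eventual row-lift transfer of orbit-closure multiplicities along closure points.**  Let `p` be a
form of degree `m` in the lexicographic matrix variables `MatIdx m` and `λ ⊢ m·δ` a shape with at most
`m²` parts.  There is `j₀` (depending on `p` and `λ` only) such that for every `j ≥ j₀` and every
NONZERO form `q` of degree `m + j` in the variables `MatIdx (m + j)` whose orbit closure contains the
padded points `X_top^j · ι(A · p)` of all INVERTIBLE `A`, one has
`mult_{λ*} ℂ[Δ_m(p)] ≤ mult_{(λ♯(m+j))*} ℂ[Δ_{m+j}(q)]`.
(Complete certificate of `p`; lifted highest-weight vectors; twisted evaluation matrix, generically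
nonsingular in `j`; certificate bridge at closure points.)
[BLMW 2011 Problem 6.10 (eventual form); Ikenmeyer–Panova 2017 Prop. 2.6(b); BIP 2019 Thm. 5.4] -/
theorem orbitMultiplicity_le_rowLift_eventually_of_closurePoints {m : ℕ} [NeZero m]
    (p : MvPolynomial (MatIdx m) ℂ) (hp : p.IsHomogeneous m) {δ : ℕ} (lam : Nat.Partition (m * δ))
    (hlam : lam.parts.card ≤ m * m) :
    ∃ j₀ : ℕ, ∀ j : ℕ, j₀ ≤ j → ∀ [NeZero (m + j)] (q : MvPolynomial (MatIdx (m + j)) ℂ),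
      q.IsHomogeneous (m + j) → q ≠ 0 →
      (∀ A : Matrix (MatIdx m) (MatIdx m) ℂ, IsUnit A →
          paddedForm m j (linSubst (MatIdx m) ℂ A p) ∈ orbitClosure q) →
      orbitMultiplicity ℂ p m (partitionWeightLex m lam) ≤
        orbitMultiplicity ℂ q (m + j) (partitionWeightLex (m + j) (rowLift lam j)) := by
  classical
  set D := orbitMultiplicity ℂ p m (partitionWeightLex m lam) with hD
  -- a complete certificate of `p` at weight `λ*`, at invertible points
  obtain ⟨F, A, hF, hA, hdet⟩ := dem_exists_evalCertificate
    p (NeZero.ne m) (partitionWeightLex m lam) (le_refl D)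
  have hhom : ∀ i, (F i).IsHomogeneous δ := fun i =>
    isHomogeneous_of_mem_highestWeightSpace (NeZero.ne m) (hF i) (size_partitionWeightLex' lam hlam)
  have hpA : ∀ l, (linSubst (MatIdx m) ℂ (A l) p).IsHomogeneous m := fun l =>
    linSubst_isHomogeneous _ hp
  -- the coefficient vectors of the certificate points and the twist in `j`
  let c : Fin D → DegIdx (MatIdx m) m → ℂ := fun l e =>
    MvPolynomial.coeff e.1 (linSubst (MatIdx m) ℂ (A l) p)
  have h0 : (Matrix.of fun i l : Fin D => aeval (c l) (F i)).det ≠ 0 := by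
    have : (Matrix.of fun i l : Fin D => aeval (c l) (F i)) =
        Matrix.of fun i l : Fin D => aeval (formCoeff m (linSubst (MatIdx m) ℂ (A l) p)) (F i) := by
      ext i l
      rfl
    rw [this]
    exact hdet
  obtain ⟨j₀, hj₀⟩ := dem_exists_forall_twistedDet_ne_zero (fun e : DegIdx (MatIdx m) m => e.1 (topMatIdx m))
    F hhom c h0
  refine ⟨j₀, fun j hj _ q hq hq0 hpts => ?_⟩
  -- the lifted certificate, evaluated at the padded points (closure points of `q`)
  refine dem_le_orbitMultiplicity_of_closure_det_ne_zero (NeZero.ne (m + j)) hq hq0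
    (partitionWeightLex (m + j) (rowLift lam j)) (fun i => liftHWV m j (F i))
    (fun i => liftHWV_mem_highestWeightSpace lam hlam j (hF i))
    (fun l => paddedForm m j (linSubst (MatIdx m) ℂ (A l) p)) (fun l => hpts (A l) (hA l)) ?_
  have hmat : (Matrix.of fun i l : Fin D => aeval
        (formCoeff (m + j) (paddedForm m j (linSubst (MatIdx m) ℂ (A l) p))) (liftHWV m j (F i))) =
      Matrix.of fun i l : Fin D => aeval
        (fun e : DegIdx (MatIdx m) m => (((e.1 (topMatIdx m) + j).descFactorial j : ℕ) : ℂ) * c l e) (F i) := by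
    ext i l
    rw [Matrix.of_apply, Matrix.of_apply, aeval_formCoeff_paddedForm_liftHWV j (hpA l)]
  rw [hmat]
  exact hj₀ j hj

/-! ## The determinant: padded points are closure points of the bigger determinant -/

/-- `det_m` in the lexicographic variables is its own affine determinantal representation of size `m`
(`detFormLex = rename toLex (det (X_{ij}))`, rename the generic matrix entrywise). [Bürgisser 2000 §2.5;
folklore] -/
theorem hasDetRepr_detFormLex (m : ℕ) : HasDetRepr (detFormLex ℂ m) m := by
  refine ⟨(rename (toLex : Fin m × Fin m → MatIdx m)).mapMatrix (Matrix.mvPolynomialX (Fin m) (Fin m) ℂ),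
    fun i j => ?_, ?_⟩
  · rw [AlgHom.mapMatrix_apply, Matrix.map_apply, Matrix.mvPolynomialX_apply, rename_X]
    exact (totalDegree_X (R := ℂ) _).le
  · rw [← AlgHom.map_det]
    rfl

/-- **Padded determinant points are closure points of the bigger determinant.**  For every
`A ∈ Mat_{m²}` (invertible or not) and every padding `j`,
`X_top^j · ι(A · det_m) ∈ Δ(det_{m+j}) = \overline{GL_{(m+j)²} · det_{m+j}}`: `A · det_m` has an affine
determinantal representation of size `m` (`hasDetRepr_linSubst`), hence of size `m + j`
(`HasDetRepr.mono_holds`), and padded forms with such a representation lie in `Ω_{m+j}`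
(`paddedForm_mem_orbitClosure_detFormLex`: Mulmuley–Sohoni's homogenisation, `End · det ⊆ Δ(det)`).
[Mulmuley–Sohoni 2001 Prop. 4.4; Ikenmeyer–Panova 2017 Lemma 2.7] -/
theorem paddedForm_linSubst_detFormLex_mem_orbitClosure (m j : ℕ) [NeZero (m + j)]
    (A : Matrix (MatIdx m) (MatIdx m) ℂ) :
    paddedForm m j (linSubst (MatIdx m) ℂ A (detFormLex ℂ m)) ∈ orbitClosure (detFormLex ℂ (m + j)) :=
  paddedForm_mem_orbitClosure_detFormLex j (linSubst_isHomogeneous _ (detFormLex_isHomogeneous ℂ m))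
    (HasDetRepr.mono_holds (hasDetRepr_linSubst A (hasDetRepr_detFormLex m)) (Nat.le_add_right m j))

/-! ## The determinant side of the size transfer -/

/-- **det_eventualMonotone** (registered stub of the size-transfer axis, wall-breaker k12, verbatim):
eventual monotonicity of the determinant's orbit-closure multiplicities along row lifts —
for every inner shape `μ ⊢ n·δ` with at most `n²` parts there is `j₀` with
`K_n(μ*) ≤ K_{n+j}((μ♯(n+j))*)` for all `j ≥ j₀`, where `K_m(λ*) = mult_{λ*} ℂ[Δ(det_m)]`
(`orbitMultiplicity ℂ (detFormLex ℂ m) m (partitionWeightLex m λ)`).  Instance of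
`orbitMultiplicity_le_rowLift_eventually_of_closurePoints` with `p = det_n`, `q = det_{n+j}`
(`paddedForm_linSubst_detFormLex_mem_orbitClosure`).  With `ValuativeBound` (proved):
`K_n(μ*) ≤ dim T_U(μ♯)` at every large level `n + j` — the det side a flip must undercut does not
decay along the ray. [BLMW 2011 Problem 6.10 (det half, eventual); Ikenmeyer–Panova 2017 §2] -/
theorem det_eventualMonotone (n δ : ℕ) [NeZero n] (μ : Nat.Partition (n * δ)) (hμ : μ.parts.card ≤ n * n) :
    ∃ j₀ : ℕ, ∀ j : ℕ, j₀ ≤ j → ∀ [NeZero (n + j)],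
      orbitMultiplicity ℂ (detFormLex ℂ n) n (partitionWeightLex n μ) ≤
        orbitMultiplicity ℂ (detFormLex ℂ (n + j)) (n + j) (partitionWeightLex (n + j) (rowLift μ j)) := by
  obtain ⟨j₀, hj₀⟩ := orbitMultiplicity_le_rowLift_eventually_of_closurePoints (detFormLex ℂ n)
    (detFormLex_isHomogeneous ℂ n) μ hμ
  -- `det_{n+j} ≠ 0` (the generic matrix has nonzero determinant), then the principle with the padded points
  refine ⟨j₀, fun j hj _ => hj₀ j hj (detFormLex ℂ (n + j)) (detFormLex_isHomogeneous ℂ (n + j))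
    (fun h => Matrix.det_mvPolynomialX_ne_zero (m := Fin (n + j)) (R := ℂ)
      (rename_injective _ toLex.injective (h.trans (map_zero _).symm)))
    fun A _ => paddedForm_linSubst_detFormLex_mem_orbitClosure n j A⟩

end

end Summit.ValiantsHypothesis.ValiantsHypothesis.Theorems.ValuativeFlip
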